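import Literature.NumberTheory.Automorphic.CuspTowerTransport
import Literature.NumberTheory.Automorphic.CuspConditionGLLieDeriv
import Literature.NumberTheory.Automorphic.AdelicHeightGLSiegel
import Literature.NumberTheory.Automorphic.AdelicHeightGLProofs
import HarnessLib

/-!
# The constant term of an automorphic form on `GL_n(𝔸_K)` along a maximal parabolic, as a
# function on `GL_n(𝔸_K)` (Borel–Jacquet 1979, 4.4; Moeglin–Waldspurger 1995, I.2.6)

Topic `NumberTheory/Automorphic`. The tree's `blockCT (le_refl n) k ν φ y =
∫_{D} φ ((1 + N) y) dν(N)` (`CuspTowerTransport`: the constant term at `y` along the unipotent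
radical `N_k = 1 + 𝔫_k` of the standard maximal parabolic `P_k` of `GL_n`, `N` ranging over Tate's
box `D ⊆ 𝔸_K^{k(n-k)}` in box coordinates, `ν` an additive Haar measure) was introduced for the
Fourier–Whittaker tower and used there only through its vanishing. For Harish-Chandra's finiteness
theorem (Borel–Jacquet 1979, 4.3 (i); the tree's named fact `harishChandra_finiteness` of
`LangAutomorphicForms`) and for the theory of Eisenstein series one needs the constant term
`φ_P : y ↦ blockCT (le_refl n) k ν φ y` as a FUNCTION on `GL_n(𝔸_K)` with the properties listed in
Moeglin–Waldspurger I.2.6. This file proves the elementary ones, for `φ` continuous and left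
`GL_n(K)`-invariant where needed:

* `blockCT_comp_mul_right`, `IsRightInvariantUnder.blockCT` — right translations commute with the
  constant term; in particular `φ_P` has the level of `φ`;
* `blockCT_add`, `blockCT_smul`, `blockCT_zero` and the integrability of the integrand
  `IsLeftInvariant.integrableOn_blockCT` (a continuous `K^{k(n-k)}`-periodic function is bounded,
  Tate's box has finite measure) — linearity;
* `IsLeftInvariant.blockCT_unipotentOfBlock_mul` — **`φ_P` is left `N_k(𝔸_K)`-invariant**
  (translation invariance of box integrals of periodic functions,
  `setIntegral_piFundamentalDomain_comp_add`);
* `CuspConditionGL.blockCT_eq_zero` and `cuspConditionGL_of_forall_blockCT_eq_zero` — **the cusp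
  condition of `AutomorphicRepsGL` along `P_k` (all Haar measures on `𝔫_k(𝔸_K)`, all measurable
  fundamental domains of `𝔫_k(K)`) is the vanishing of `φ_P` for all Haar measures on the box**
  (transport along `blockMatrixEquiv`, change of fundamental domain by periodicity);
* `exists_norm_blockCT_le` — **`φ_P` has moderate growth with the exponent of `φ`** (`‖(1 + N) y‖ ≤ C ‖1 + N‖ ‖y‖`, `adelicHeightGL_mul_le_holds`, and `‖1 + N‖` is bounded on
  the relatively compact box, `exists_adelicHeightGL_le_of_isCompact`).

Not here (next steps of the programme): smoothness and `K_∞`- and `Z(𝔤)`-finiteness of `φ_P`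
(differentiation under the integral, as in `CuspConditionGLLieDeriv`), left invariance under the
rational points of the Levi subgroup, and the behaviour on the Levi `GL_k × GL_{n-k}`.
Everything here is proved: theorems only, no definition, no named fact.

## References

* A. Borel, H. Jacquet, *Automorphic forms and automorphic representations*, Proc. Sympos. Pure
  Math. 33 (Corvallis 1977), Part 1 (1979), 4.3–4.4 [BorelJacquet1979].
* C. Moeglin, J.-L. Waldspurger, *Spectral decomposition and Eisenstein series*, Cambridge Tracts
  in Math. 113 (1995), I.2.6 (constant terms: definition and elementary properties)
  [MoeglinWaldspurger1995].
* J. Tate, in Cassels–Fröhlich (1967), Ch. XV, Lemma 4.2.1 [CasselsFrohlichANT1967].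
-/

noncomputable section

open scoped Matrix
open NumberField IsDedekindDomain MeasureTheory Set Filter

namespace Literature.NumberTheory.Automorphic

variable {K : Type} [Field K] [NumberField K]
  [MeasurableSpace (AdeleRing (𝓞 K) K)] [BorelSpace (AdeleRing (𝓞 K) K)] {n : ℕ}

/-! ### 1. Right translations and linearity -/

section Right

omit [BorelSpace (AdeleRing (𝓞 K) K)] in
/-- **Right translations commute with the constant term**: the constant term of `x ↦ φ (x h)` at
`y` is the constant term of `φ` at `y h` (the unipotent variable is on the left). Moeglin–Waldspurger
1995, I.2.6. [cite: MoeglinWaldspurger1995, I.2.6] -/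
theorem blockCT_comp_mul_right {c : ℕ} (hc : c ≤ n) (k : ℕ)
    (ν : Measure (BlockIdx c k → AdeleRing (𝓞 K) K)) (φ : GL (Fin n) (AdeleRing (𝓞 K) K) → ℂ)
    (h y : GL (Fin n) (AdeleRing (𝓞 K) K)) :
    blockCT hc k ν (fun x => φ (x * h)) y = blockCT hc k ν φ (y * h) := by
  simp only [blockCT_apply, mul_assoc]

omit [BorelSpace (AdeleRing (𝓞 K) K)] in
/-- **The constant term has the level of the form**: if `φ` is right invariant under `U`, so is
`y ↦ blockCT hc k ν φ y`. Moeglin–Waldspurger 1995, I.2.6. [cite: MoeglinWaldspurger1995, I.2.6] -/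
theorem IsRightInvariantUnder.blockCT {c : ℕ} (hc : c ≤ n) (k : ℕ)
    (ν : Measure (BlockIdx c k → AdeleRing (𝓞 K) K)) {U : Subgroup (GL (Fin n) (AdeleRing (𝓞 K) K))}
    {φ : GL (Fin n) (AdeleRing (𝓞 K) K) → ℂ} (hφ : IsRightInvariantUnder U φ) :
    IsRightInvariantUnder U (blockCT hc k ν φ) := by
  intro u hu y
  rw [← blockCT_comp_mul_right]
  simp only [blockCT_apply, hφ u hu]

omit [BorelSpace (AdeleRing (𝓞 K) K)] in
/-- The constant term of the zero function vanishes. [folklore] -/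
theorem blockCT_zero {c : ℕ} (hc : c ≤ n) (k : ℕ) (ν : Measure (BlockIdx c k → AdeleRing (𝓞 K) K))
    (y : GL (Fin n) (AdeleRing (𝓞 K) K)) :
    blockCT hc k ν (0 : GL (Fin n) (AdeleRing (𝓞 K) K) → ℂ) y = 0 := by
  simp [blockCT_apply]

omit [BorelSpace (AdeleRing (𝓞 K) K)] in
/-- The constant term is homogeneous: `(a φ)_P = a φ_P`. [folklore] -/
theorem blockCT_smul {c : ℕ} (hc : c ≤ n) (k : ℕ) (ν : Measure (BlockIdx c k → AdeleRing (𝓞 K) K))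
    (a : ℂ) (φ : GL (Fin n) (AdeleRing (𝓞 K) K) → ℂ) (y : GL (Fin n) (AdeleRing (𝓞 K) K)) :
    blockCT hc k ν (a • φ) y = a • blockCT hc k ν φ y := by
  simp only [blockCT_apply, Pi.smul_apply, integral_smul]

omit [BorelSpace (AdeleRing (𝓞 K) K)] in
/-- The constant term is additive on functions whose integrands are integrable on the box.
[folklore] -/
theorem blockCT_add {c : ℕ} (hc : c ≤ n) (k : ℕ) (ν : Measure (BlockIdx c k → AdeleRing (𝓞 K) K))
    {φ ψ : GL (Fin n) (AdeleRing (𝓞 K) K) → ℂ} {y : GL (Fin n) (AdeleRing (𝓞 K) K)}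
    (hφ : IntegrableOn (fun N => φ (glCorner (AdeleRing (𝓞 K) K) hc
      (unipotentOfBlock c k (AdeleRing (𝓞 K) K)
        (Multiplicative.ofAdd (blockMatrixEquiv (AdeleRing (𝓞 K) K) c k N))) * y))
      (piFundamentalDomain K (BlockIdx c k)) ν)
    (hψ : IntegrableOn (fun N => ψ (glCorner (AdeleRing (𝓞 K) K) hc
      (unipotentOfBlock c k (AdeleRing (𝓞 K) K)
        (Multiplicative.ofAdd (blockMatrixEquiv (AdeleRing (𝓞 K) K) c k N))) * y))
      (piFundamentalDomain K (BlockIdx c k)) ν) :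
    blockCT hc k ν (φ + ψ) y = blockCT hc k ν φ y + blockCT hc k ν ψ y := by
  simp only [blockCT_apply, Pi.add_apply]
  exact integral_add hφ hψ

end Right

/-! ### 2. Periodicity, boundedness and integrability of the integrand -/

section Periodic

variable {k : ℕ}

omit [MeasurableSpace (AdeleRing (𝓞 K) K)] [BorelSpace (AdeleRing (𝓞 K) K)] in
/-- **Periodicity of the integrand under `K^{k(n-k)}`**: for `φ` left `GL_n(K)`-invariant, shifting
the box variable by a rational vector `ξ` does not change `φ ((1 + N) y)`, because
`1 + (N + ξ) = (1 + ξ)(1 + N)` and `1 + ξ ∈ GL_n(K)`. Borel–Jacquet 1979, 4.4. [cite: BorelJacquet1979, 4.4] -/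
theorem IsLeftInvariant.apply_unipotentOfBlock_blockMatrixEquiv_add
    {φ : GL (Fin n) (AdeleRing (𝓞 K) K) → ℂ} (hφ : IsLeftInvariant (AdelicGroupData.gl n K) φ)
    (N : BlockIdx n k → AdeleRing (𝓞 K) K) (ξ : BlockIdx n k → K)
    (y : GL (Fin n) (AdeleRing (𝓞 K) K)) :
    φ (unipotentOfBlock n k (AdeleRing (𝓞 K) K) (Multiplicative.ofAdd
        (blockMatrixEquiv (AdeleRing (𝓞 K) K) n k
          (N + fun i => algebraMap K (AdeleRing (𝓞 K) K) (ξ i)))) * y) =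
      φ (unipotentOfBlock n k (AdeleRing (𝓞 K) K) (Multiplicative.ofAdd
        (blockMatrixEquiv (AdeleRing (𝓞 K) K) n k N)) * y) := by
  have hrat : blockMatrixEquiv (AdeleRing (𝓞 K) K) n k
      (fun i => algebraMap K (AdeleRing (𝓞 K) K) (ξ i)) ∈ rationalBlock n k K :=
    (blockMatrixEquiv_mem_rationalBlock_iff _).2 fun i _ => ⟨ξ i, rfl⟩
  rw [map_add, add_comm, ofAdd_add, map_mul, mul_assoc]
  exact hφ _ (glUnipotent_mem_arithmeticSubgroup hrat) _

omit [MeasurableSpace (AdeleRing (𝓞 K) K)] [BorelSpace (AdeleRing (𝓞 K) K)] in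
/-- The integrand `N ↦ φ ((1 + N) y)` is continuous for continuous `φ`. [folklore] -/
theorem continuous_apply_unipotentOfBlock_blockMatrixEquiv
    {φ : GL (Fin n) (AdeleRing (𝓞 K) K) → ℂ} (hφc : Continuous φ)
    (y : GL (Fin n) (AdeleRing (𝓞 K) K)) :
    Continuous fun N : BlockIdx n k → AdeleRing (𝓞 K) K =>
      φ (unipotentOfBlock n k (AdeleRing (𝓞 K) K) (Multiplicative.ofAdd
        (blockMatrixEquiv (AdeleRing (𝓞 K) K) n k N)) * y) :=
  hφc.comp ((continuous_unipotentOfBlock_ofAdd'.comp (continuous_blockMatrixEquiv n k)).mul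
    continuous_const)

omit [MeasurableSpace (AdeleRing (𝓞 K) K)] [BorelSpace (AdeleRing (𝓞 K) K)] in
/-- **A continuous left-invariant `φ` gives a bounded integrand**: there is `M` with
`‖φ ((1 + N) y)‖ ≤ M` for ALL `N ∈ 𝔸_K^{k(n-k)}` (every `N` is a rational translate of a point of
Tate's box, whose closure is compact). [folklore] -/
theorem IsLeftInvariant.exists_forall_norm_apply_unipotentOfBlock_le
    {φ : GL (Fin n) (AdeleRing (𝓞 K) K) → ℂ} (hφc : Continuous φ)
    (hφ : IsLeftInvariant (AdelicGroupData.gl n K) φ) (y : GL (Fin n) (AdeleRing (𝓞 K) K)) :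
    ∃ M : ℝ, ∀ N : BlockIdx n k → AdeleRing (𝓞 K) K,
      ‖φ (unipotentOfBlock n k (AdeleRing (𝓞 K) K) (Multiplicative.ofAdd
        (blockMatrixEquiv (AdeleRing (𝓞 K) K) n k N)) * y)‖ ≤ M := by
  obtain ⟨M, hM⟩ := (isCompact_closure_piFundamentalDomain K (BlockIdx n k)).exists_bound_of_continuousOn
    (continuous_apply_unipotentOfBlock_blockMatrixEquiv hφc y).continuousOn
  refine ⟨M, fun N => ?_⟩
  obtain ⟨γ, hγ, d, hd, rfl⟩ :=
    exists_mem_piPrincipalSubgroup_add_mem_piFundamentalDomain K (BlockIdx n k) N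
  obtain ⟨ξ, hξ⟩ := (piPrincipalSubgroupEquiv K (BlockIdx n k)).surjective ⟨γ, hγ⟩
  have hγξ : γ = fun i => algebraMap K (AdeleRing (𝓞 K) K) (ξ i) := by
    have h := congrArg Subtype.val hξ
    rw [coe_piPrincipalSubgroupEquiv] at h
    exact h.symm
  rw [hγξ, add_comm, hφ.apply_unipotentOfBlock_blockMatrixEquiv_add d ξ y]
  exact hM d (subset_closure hd)

/-- **The integrand of the constant term is integrable on Tate's box** (and on every set of finite
measure), for `φ` continuous and left `GL_n(K)`-invariant and any measure finite on compact sets: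
it is continuous and bounded, and the box has compact closure. [folklore] -/
theorem IsLeftInvariant.integrableOn_blockCT
    {φ : GL (Fin n) (AdeleRing (𝓞 K) K) → ℂ} (hφc : Continuous φ)
    (hφ : IsLeftInvariant (AdelicGroupData.gl n K) φ)
    (ν : Measure (BlockIdx n k → AdeleRing (𝓞 K) K)) [IsFiniteMeasureOnCompacts ν]
    (y : GL (Fin n) (AdeleRing (𝓞 K) K)) :
    IntegrableOn (fun N => φ (glCorner (AdeleRing (𝓞 K) K) (le_refl n)
      (unipotentOfBlock n k (AdeleRing (𝓞 K) K)
        (Multiplicative.ofAdd (blockMatrixEquiv (AdeleRing (𝓞 K) K) n k N))) * y))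
      (piFundamentalDomain K (BlockIdx n k)) ν := by
  haveI := t2Space_adeleRing K
  haveI := secondCountableTopology_adeleRing K
  haveI : BorelSpace (BlockIdx n k → AdeleRing (𝓞 K) K) := Pi.borelSpace
  simp_rw [glCorner_refl]
  obtain ⟨M, hM⟩ := hφ.exists_forall_norm_apply_unipotentOfBlock_le (k := k) hφc y
  have hfin : ν (piFundamentalDomain K (BlockIdx n k)) < ⊤ :=
    (measure_mono subset_closure).trans_lt
      (isCompact_closure_piFundamentalDomain K (BlockIdx n k)).measure_lt_top
  exact Measure.integrableOn_of_bounded (M := M) hfin.ne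
    (continuous_apply_unipotentOfBlock_blockMatrixEquiv hφc y).aestronglyMeasurable
    (Eventually.of_forall hM)

end Periodic

/-! ### 3. Left invariance under `N_k(𝔸_K)` -/

section LeftUnipotent

variable {k : ℕ}

/-- **The constant term along `P_k` is left `N_k(𝔸_K)`-invariant**: for `φ` continuous and left
`GL_n(K)`-invariant, an additive Haar measure `ν` on the box and `X ∈ 𝔫_k(𝔸_K)`,
`φ_P ((1 + X) y) = φ_P (y)` — the integrand at `(1 + X) y` is the translate by the box coordinates
of `X` of the integrand at `y` (`(1 + N)(1 + X) = 1 + (N + X)`), and translations do not change box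
integrals of `K^{k(n-k)}`-periodic continuous functions (`setIntegral_piFundamentalDomain_comp_add`).
Moeglin–Waldspurger 1995, I.2.6 (`φ_P` is a function on `N(𝔸) M(k) \ G(𝔸)`). [cite: MoeglinWaldspurger1995, I.2.6] -/
theorem IsLeftInvariant.blockCT_unipotentOfBlock_mul
    {φ : GL (Fin n) (AdeleRing (𝓞 K) K) → ℂ} (hφc : Continuous φ)
    (hφ : IsLeftInvariant (AdelicGroupData.gl n K) φ)
    (ν : Measure (BlockIdx n k → AdeleRing (𝓞 K) K)) [ν.IsAddHaarMeasure]
    (X : blockNilpotent n k (AdeleRing (𝓞 K) K)) (y : GL (Fin n) (AdeleRing (𝓞 K) K)) :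
    blockCT (le_refl n) k ν φ (unipotentOfBlock n k (AdeleRing (𝓞 K) K) (Multiplicative.ofAdd X) * y) =
      blockCT (le_refl n) k ν φ y := by
  rw [blockCT_apply, blockCT_apply]
  simp_rw [glCorner_refl]
  set s : BlockIdx n k → AdeleRing (𝓞 K) K := (blockMatrixEquiv (AdeleRing (𝓞 K) K) n k).symm X with hs
  -- the integrand at `(1 + X) y` is the translate by `s` of the integrand at `y`
  have hshift : ∀ N : BlockIdx n k → AdeleRing (𝓞 K) K,
      unipotentOfBlock n k (AdeleRing (𝓞 K) K) (Multiplicative.ofAdd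
          (blockMatrixEquiv (AdeleRing (𝓞 K) K) n k N)) *
        (unipotentOfBlock n k (AdeleRing (𝓞 K) K) (Multiplicative.ofAdd X) * y) =
      unipotentOfBlock n k (AdeleRing (𝓞 K) K) (Multiplicative.ofAdd
          (blockMatrixEquiv (AdeleRing (𝓞 K) K) n k (N + s))) * y := by
    intro N
    rw [map_add, hs, AddEquiv.apply_symm_apply, ofAdd_add, map_mul, mul_assoc]
  simp_rw [hshift]
  exact setIntegral_piFundamentalDomain_comp_add ν s
    (continuous_apply_unipotentOfBlock_blockMatrixEquiv hφc y)
    (fun N ξ => hφ.apply_unipotentOfBlock_blockMatrixEquiv_add N ξ y)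

end LeftUnipotent

/-! ### 4. The cusp condition along `P_k` is the vanishing of the constant term -/

section Cusp

variable {k : ℕ}

/-- **If the constant term of `φ` along `P_k` vanishes in the sense of `CuspConditionGL` (all Haar
measures on `𝔫_k(𝔸_K)`, all measurable fundamental domains of `𝔫_k(K)`), then
`blockCT (le_refl n) k ν φ = 0` for every additive Haar measure `ν` on the box** (transport `ν`
along the box coordinates `blockMatrixEquiv`; the image of Tate's box is a fundamental domain;
`glCorner (le_refl n) = id`). This is `towerCusp_of_cuspConditionGL` of `CuspTowerTransport` for a
single `k`. Borel–Jacquet 1979, 4.4. [cite: BorelJacquet1979, 4.4] -/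
theorem CuspConditionGL.blockCT_eq_zero {φ : GL (Fin n) (AdeleRing (𝓞 K) K) → ℂ}
    (hφ : CuspConditionGL n K φ k) (ν : Measure (BlockIdx n k → AdeleRing (𝓞 K) K))
    [ν.IsAddHaarMeasure] (y : GL (Fin n) (AdeleRing (𝓞 K) K)) :
    blockCT (le_refl n) k ν φ y = 0 := by
  haveI := t2Space_adeleRing K
  haveI := secondCountableTopology_adeleRing K
  haveI : BorelSpace (BlockIdx n k → AdeleRing (𝓞 K) K) := Pi.borelSpace
  haveI := isAddHaarMeasure_map_blockMatrixEquiv (K := K) (m := n) (k := k) ν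
  have h0 := (hφ (Measure.map (blockMatrixEquiv (AdeleRing (𝓞 K) K) n k) ν)
    (blockMatrixEquiv (AdeleRing (𝓞 K) K) n k '' piFundamentalDomain K (BlockIdx n k))
    (isAddFundamentalDomain_image_blockMatrixEquiv ν) y).2
  have hme : MeasurableEmbedding (blockMatrixEquiv (AdeleRing (𝓞 K) K) n k) :=
    (blockMatrixHomeomorph (AdeleRing (𝓞 K) K) n k).measurableEmbedding
  rw [(measurePreserving_blockMatrixEquiv (K := K) ν).setIntegral_image_emb hme] at h0
  rw [blockCT_apply]
  simp_rw [glCorner_refl]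
  exact h0

/-- **Conversely, for `φ` continuous and left `GL_n(K)`-invariant, the vanishing of
`blockCT (le_refl n) k ν φ` for every additive Haar measure `ν` on the box implies the cusp
condition `CuspConditionGL n K φ k`**: given a Haar measure `ν'` on `𝔫_k(𝔸_K)` and a measurable
fundamental domain `𝓕` of `𝔫_k(K)`, the integrand is integrable on `𝓕` (bounded by periodicity,
`𝓕` has the finite measure of Tate's box), its integral over `𝓕` equals the one over the image of
the box (`IsAddFundamentalDomain.setIntegral_eq`, periodicity), and `ν'` is the transport of the
Haar measure `ν'.map (blockMatrixEquiv)⁻¹` of the box, on which the integral is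
`blockCT (le_refl n) k _ φ y = 0`. Borel–Jacquet 1979, 4.4. [cite: BorelJacquet1979, 4.4] -/
theorem cuspConditionGL_of_forall_blockCT_eq_zero {φ : GL (Fin n) (AdeleRing (𝓞 K) K) → ℂ}
    (hφc : Continuous φ) (hφ : IsLeftInvariant (AdelicGroupData.gl n K) φ)
    (h0 : ∀ ν : Measure (BlockIdx n k → AdeleRing (𝓞 K) K), ν.IsAddHaarMeasure →
      ∀ y : GL (Fin n) (AdeleRing (𝓞 K) K), blockCT (le_refl n) k ν φ y = 0) :
    CuspConditionGL n K φ k := by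
  intro ν' hν' 𝓕 h𝓕 y'
  obtain ⟨y, rfl⟩ : ∃ y : GL (Fin n) (AdeleRing (𝓞 K) K), y = y' := ⟨y', rfl⟩
  haveI := t2Space_adeleRing K
  haveI := secondCountableTopology_adeleRing K
  haveI : BorelSpace (BlockIdx n k → AdeleRing (𝓞 K) K) := Pi.borelSpace
  haveI : Countable (rationalBlock n k K) := rationalBlock_countable
  -- the Haar measure of the box of which `ν'` is the transport
  set e := blockMatrixEquiv (AdeleRing (𝓞 K) K) n k with he
  set νb : Measure (BlockIdx n k → AdeleRing (𝓞 K) K) := Measure.map e.symm ν' with hνb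
  haveI : νb.IsAddHaarMeasure :=
    AddEquiv.isAddHaarMeasure_map ν' e.symm (continuous_blockMatrixEquiv_symm n k)
      (continuous_blockMatrixEquiv n k)
  have hme : MeasurableEmbedding e := (blockMatrixHomeomorph (AdeleRing (𝓞 K) K) n k).measurableEmbedding
  have hmap : Measure.map e νb = ν' := by
    rw [hνb, Measure.map_map (continuous_blockMatrixEquiv n k).measurable
      (continuous_blockMatrixEquiv_symm n k).measurable]
    have : (e : (BlockIdx n k → AdeleRing (𝓞 K) K) → blockNilpotent n k (AdeleRing (𝓞 K) K)) ∘
        e.symm = id := funext fun x => e.apply_symm_apply x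
    rw [this, Measure.map_id]
  -- the integrand on `𝔫_k(𝔸_K)`: continuous, periodic, bounded
  let F : blockNilpotent n k (AdeleRing (𝓞 K) K) → ℂ := fun X =>
    φ (unipotentOfBlock n k (AdeleRing (𝓞 K) K) (Multiplicative.ofAdd X) * y)
  have hFc : Continuous F := hφc.comp (continuous_unipotentOfBlock_ofAdd'.mul continuous_const)
  have hFper : ∀ (γ : rationalBlock n k K) (X : blockNilpotent n k (AdeleRing (𝓞 K) K)),
      F (γ +ᵥ X) = F X := fun γ X => hφ.apply_glUnipotent_vadd_mul γ X y
  obtain ⟨M, hM⟩ := hφ.exists_forall_norm_apply_unipotentOfBlock_le (k := k) hφc y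
  have hFbd : ∀ X, ‖F X‖ ≤ M := fun X => by
    have h := hM (e.symm X)
    rw [AddEquiv.apply_symm_apply] at h
    exact h
  -- the image of the box is a fundamental domain of the same (finite) measure as `𝓕`
  have h𝓕₀ : IsAddFundamentalDomain (rationalBlock n k K)
      (e '' piFundamentalDomain K (BlockIdx n k)) ν' := by
    have h := isAddFundamentalDomain_image_blockMatrixEquiv (K := K) (m := n) (k := k) νb
    rwa [hmap] at h
  have hmeas : ν' 𝓕 = ν' (e '' piFundamentalDomain K (BlockIdx n k)) := h𝓕.measure_eq h𝓕₀
  have hfin : ν' 𝓕 < ⊤ := by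
    rw [hmeas, ← hmap, hme.map_apply, Set.preimage_image_eq _ e.injective]
    exact (measure_mono subset_closure).trans_lt
      (isCompact_closure_piFundamentalDomain K (BlockIdx n k)).measure_lt_top
  refine ⟨Measure.integrableOn_of_bounded (M := M) hfin.ne hFc.aestronglyMeasurable
    (Eventually.of_forall hFbd), ?_⟩
  change ∫ X in 𝓕, F X ∂ν' = 0
  rw [h𝓕.setIntegral_eq h𝓕₀ hFper, ← hmap,
    (measurePreserving_blockMatrixEquiv (K := K) νb).setIntegral_image_emb hme]
  have h := h0 νb inferInstance y
  rw [blockCT_apply] at h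
  simp_rw [glCorner_refl] at h
  exact h

/-- **The cusp condition along `P_k` is the vanishing of the constant term** (for `φ` continuous
and left `GL_n(K)`-invariant, e.g. an automorphic form): `CuspConditionGL n K φ k` holds iff
`blockCT (le_refl n) k ν φ = 0` for every additive Haar measure `ν` on the box.
Borel–Jacquet 1979, 4.4. [cite: BorelJacquet1979, 4.4] -/
theorem cuspConditionGL_iff_forall_blockCT_eq_zero {φ : GL (Fin n) (AdeleRing (𝓞 K) K) → ℂ}
    (hφc : Continuous φ) (hφ : IsLeftInvariant (AdelicGroupData.gl n K) φ) :
    CuspConditionGL n K φ k ↔ ∀ ν : Measure (BlockIdx n k → AdeleRing (𝓞 K) K),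
      ν.IsAddHaarMeasure → ∀ y : GL (Fin n) (AdeleRing (𝓞 K) K), blockCT (le_refl n) k ν φ y = 0 :=
  ⟨fun h ν hν y => by haveI := hν; exact h.blockCT_eq_zero ν y,
    cuspConditionGL_of_forall_blockCT_eq_zero hφc hφ⟩

end Cusp

/-! ### 5. Moderate growth -/

section Growth

variable {k : ℕ}

omit [BorelSpace (AdeleRing (𝓞 K) K)] in
/-- **The constant term has moderate growth, with the exponent of `φ`**: if
`‖φ (x)‖ ≤ C (1 ⊔ ‖x‖)^r` for the adelic height `‖·‖` (`adelicHeightGL`), then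
`‖φ_P (y)‖ ≤ C' (1 ⊔ ‖y‖)^r` for every measure finite on compact sets on the box (no continuity or
invariance is needed for this bound): `‖(1 + N) y‖ ≤ C₁ ‖1 + N‖ ‖y‖` (`adelicHeightGL_mul_le_holds`)
and `‖1 + N‖` is bounded for `N` in the relatively compact box (`exists_adelicHeightGL_le_of_isCompact`).
Moeglin–Waldspurger 1995, I.2.6 ("`φ_P` has moderate growth"). [cite: MoeglinWaldspurger1995, I.2.6] -/
theorem exists_norm_blockCT_le {φ : GL (Fin n) (AdeleRing (𝓞 K) K) → ℂ}
    (ν : Measure (BlockIdx n k → AdeleRing (𝓞 K) K)) [IsFiniteMeasureOnCompacts ν]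
    {C : ℝ} {r : ℕ} (hC : 0 ≤ C)
    (hgrowth : ∀ x, ‖φ x‖ ≤ C * (1 ⊔ adelicHeightGL n K x) ^ r) :
    ∃ C' : ℝ, ∀ y : GL (Fin n) (AdeleRing (𝓞 K) K),
      ‖blockCT (le_refl n) k ν φ y‖ ≤ C' * (1 ⊔ adelicHeightGL n K y) ^ r := by
  haveI := t2Space_adeleRing K
  -- the unipotents of the closure of the box form a compact set of bounded height
  set S : Set (GL (Fin n) (AdeleRing (𝓞 K) K)) := (fun N : BlockIdx n k → AdeleRing (𝓞 K) K =>
    unipotentOfBlock n k (AdeleRing (𝓞 K) K) (Multiplicative.ofAdd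
      (blockMatrixEquiv (AdeleRing (𝓞 K) K) n k N))) '' closure (piFundamentalDomain K (BlockIdx n k))
    with hS
  have hSc : IsCompact S := (isCompact_closure_piFundamentalDomain K (BlockIdx n k)).image
    (continuous_unipotentOfBlock_ofAdd'.comp (continuous_blockMatrixEquiv n k))
  obtain ⟨B, hB0, hB⟩ := exists_adelicHeightGL_le_of_isCompact hSc
  obtain ⟨C₁, hC₁⟩ := adelicHeightGL_mul_le_holds (n := n) (K := K)
  -- a nonnegative multiplicative constant
  set A : ℝ := 1 ⊔ (C₁ * B) with hA
  have hA1 : 1 ≤ A := le_sup_left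
  have hA0 : 0 ≤ A := zero_le_one.trans hA1
  have hheight : ∀ N ∈ piFundamentalDomain K (BlockIdx n k), ∀ y : GL (Fin n) (AdeleRing (𝓞 K) K),
      1 ⊔ adelicHeightGL n K (unipotentOfBlock n k (AdeleRing (𝓞 K) K) (Multiplicative.ofAdd
        (blockMatrixEquiv (AdeleRing (𝓞 K) K) n k N)) * y) ≤ A * (1 ⊔ adelicHeightGL n K y) := by
    intro N hN y
    set u := unipotentOfBlock n k (AdeleRing (𝓞 K) K) (Multiplicative.ofAdd
      (blockMatrixEquiv (AdeleRing (𝓞 K) K) n k N)) with hu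
    have huS : u ∈ S := ⟨N, subset_closure hN, rfl⟩
    have hy0 : 0 ≤ adelicHeightGL n K y := adelicHeightGL_nonneg y
    have h1 : adelicHeightGL n K (u * y) ≤ A * (1 ⊔ adelicHeightGL n K y) := by
      refine (hC₁ u y).trans ?_
      rcases le_or_gt 0 C₁ with hC₁0 | hC₁0
      · calc C₁ * adelicHeightGL n K u * adelicHeightGL n K y
            ≤ C₁ * B * adelicHeightGL n K y := by
              have := hB u huS
              gcongr
          _ ≤ A * (1 ⊔ adelicHeightGL n K y) := by
              refine mul_le_mul le_sup_right le_sup_right hy0 hA0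
      · have hneg : C₁ * adelicHeightGL n K u * adelicHeightGL n K y ≤ 0 :=
          mul_nonpos_of_nonpos_of_nonneg
            (mul_nonpos_of_nonpos_of_nonneg hC₁0.le (adelicHeightGL_nonneg u)) hy0
        exact hneg.trans (mul_nonneg hA0 (zero_le_one.trans le_sup_left))
    refine sup_le ?_ h1
    calc (1 : ℝ) ≤ A * 1 := by rw [mul_one]; exact hA1
      _ ≤ A * (1 ⊔ adelicHeightGL n K y) := mul_le_mul_of_nonneg_left le_sup_left hA0
  have hfin : ν (piFundamentalDomain K (BlockIdx n k)) < ⊤ :=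
    (measure_mono subset_closure).trans_lt
      (isCompact_closure_piFundamentalDomain K (BlockIdx n k)).measure_lt_top
  refine ⟨C * A ^ r * (ν.real (piFundamentalDomain K (BlockIdx n k))), fun y => ?_⟩
  rw [blockCT_apply]
  simp_rw [glCorner_refl]
  have hbound : ∀ N ∈ piFundamentalDomain K (BlockIdx n k),
      ‖φ (unipotentOfBlock n k (AdeleRing (𝓞 K) K) (Multiplicative.ofAdd
        (blockMatrixEquiv (AdeleRing (𝓞 K) K) n k N)) * y)‖ ≤
        C * A ^ r * (1 ⊔ adelicHeightGL n K y) ^ r := by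
    intro N hN
    refine (hgrowth _).trans ?_
    rw [mul_assoc, ← mul_pow]
    exact mul_le_mul_of_nonneg_left (pow_le_pow_left₀ (zero_le_one.trans le_sup_left)
      (hheight N hN y) r) hC
  calc ‖∫ N in piFundamentalDomain K (BlockIdx n k), φ (unipotentOfBlock n k (AdeleRing (𝓞 K) K)
          (Multiplicative.ofAdd (blockMatrixEquiv (AdeleRing (𝓞 K) K) n k N)) * y) ∂ν‖
        ≤ C * A ^ r * (1 ⊔ adelicHeightGL n K y) ^ r * ν.real (piFundamentalDomain K (BlockIdx n k)) :=
          norm_setIntegral_le_of_norm_le_const hfin hbound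
    _ = C * A ^ r * ν.real (piFundamentalDomain K (BlockIdx n k)) * (1 ⊔ adelicHeightGL n K y) ^ r := by
          ring

end Growth

end Literature.NumberTheory.Automorphic
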